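import Literature.NumberTheory.Automorphic.UnitaryLevelOneDepthOneValueClassRamified    -- ★ p847189 (this seat): one-class dictionary; brings ★ p847117 guards, ★ p846992 §B, ★ p846957 frame transport (`dotProduct_smul_formCongr_mul_mulVec`), ★ p846931 (`dotProduct_mulVec_conj_of_mem`), ★ O8b (`redMat_conj_sub_one_eq`, `rank_redMat_coe_conj_sub_one_eq_iff`)
import Literature.NumberTheory.Rogawski1990.UnitFundamentalLemmaFrameOfFormCongr                 -- ★ p846897 (F0P3a-p04 (g17)): the frame `e : G′_v ≃ₜ* U(σ_w, Φ₃)(L_w)`, `e g = A·g_w·A⁻¹`, `g ∈ K′ ↔ e g ∈ GL₃(𝒪_w)`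
import Literature.NumberTheory.Automorphic.ResiduallyUnipotentFixedCosetCount                    -- ★ `ncard_fixedBy_sep_congr` (predicate-generic transport of fixed-coset counts along a group isomorphism)
import HarnessLib

/-!
# «A1′ COUNT TRANSPORT», part 1 (A-file): the two-layer LABELS under the frame `x ↦ A·x_w·A⁻¹` and under `U ∩ GL₃(𝒪_w)`-conjugation, the reduced frame identity
# `J̄ = red(−det H′_w) • ᵗĀ J₀ Ā`, residual units of integral unitary elements, and the MASTER fixed-coset transport along ★ p846897's frame (tame-ramified non-split place)

Topic `NumberTheory/Automorphic`; namespace `Literature.NumberTheory.Automorphic.UnitaryGroup`.  THEOREMS ONLY (no definition, no instance, no notation, no named fact, no `sorry`).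
Hand F0P3a-p05 (g16), 2026-09-01.  Cell `pub/hodgecm-mathlib`, crux H413 = `stmt-HodgeConjecture-24833`; road «S3-ram» (LEAD F0P3a-plan (g12); owner∕table F0P3a-p06 (g15)); architect
A-p16 (g31) ROAD-P1ram v2, deal 23:15:56Z «(ii) A1′ COUNT TRANSPORT» (p05): v5's A′ assembly reads A1 (★ p847154: `Φ(⟦t⟧, g) = ν(K′)·Σ_j c_j(g)·n_j(t)`, counts over
`Fix_t(G′_v ⧸ K′)`) ∘ A1′ (this) ∘ A2 (F0P3a-p01 (g16) (C5), lattice currency in `U(σ_w, Φ₃)`).  PART 1 (this file) = cosets → cosets along the frame; PART 2 (cosets of `U(σ_w,Φ₃)` →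
fixed self-dual LATTICES with (a1)∕(a2)'s labels) follows once (C5)'s label tokens are posted.

THE MATHEMATICS ([Rogawski1990] §14.2 p. 233 «`K_v ≃ K′_v`», §4.9 p. 54; [Kottwitz1986] §3; [Flicker1998] §2).  The frame of ★ p846897, `e : G′_v ≃ₜ* U := U(σ_w, Φ₃)(L_w)` with
`(e g) = A·g_w·A⁻¹` (`A ∈ GL₃(𝒪_w)`, `H′_w = (−det H′_w)•ᵗσ̄A Φ₃ A`) and `g ∈ K′ ⟺ e g ∈ GL₃(𝒪_w)`, induces `G′_v ⧸ K′ ≃ U ⧸ (U ∩ GL₃(𝒪_w))` matching fixed cosets (★ `ncard_fixedBy_sep_congr`);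
the two-layer LABEL of `x = q⁻¹tq ∈ K′` and of `e x = A x_w A⁻¹ ∈ U ∩ GL₃(𝒪_w)` correspond as follows (§1, any field): `rank(red(AXA⁻¹) − 1) = rank(red X − 1)` (★ O8b); on the interior
(`rank = 0` ⇒ `ϖ⁻¹(X − 1)` integral, ★ ROW-0) `N(AXA⁻¹) = Ā·N(X)·Ā⁻¹`, same rank; and the residual quadratic form transforms by the FRAME TWIST: with `J̄ = red H′_w = c̄ • ᵗĀ J₀ Ā`
(`c̄ = red(−det H′_w)`, `J₀ = red Φ₃,w = antidiag(1,1,1)`), `zᵀ(J̄ N)z = c̄ · (Āz)ᵀ(J₀ · ĀNĀ⁻¹)(Āz)` (★ p846957) — so the class «∃ z a, a ≠ 0 ∧ zᵀ(J̄N(x))z = a²» of ★ p847154 becomes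
«∃ z a, a ≠ 0 ∧ c̄·zᵀ(J₀ N(e x))z = a²» in the model.  Each label is invariant under conjugation by `U ∩ GL₃(𝒪_w)` (★ `rank_redMat_coe_conj_sub_one_eq_iff`; `N(k⁻¹uk) = k̄⁻¹N(u)k̄` with
`k̄ ∈ O(J₀)(𝓀_w)` by reduction of unitarity at a ramified place, and ★ `dotProduct_mulVec_conj_of_mem`), which is what ★ `ncard_fixedBy_sep_congr` needs.  RESULT (§3): for every
`t ∈ G′_v`, **`n_j(t) = n′_j(e t)`** for `j ∈ {bd, 0, reg, □, ¬□}`, the primed counts over `q′ ∈ Fix_{e t}(U ⧸ U ∩ GL₃(𝒪_w))` with `u := q′.out⁻¹ (e t) q′.out` and labels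
`rank(red u − 1) = 2` ∣ `rank(red u − 1) = 0 ∧ rank N(u) = 0 ∕ 2` ∣ `rank(red u − 1) = 0 ∧ rank N(u) = 1 ∧ (¬)∃ z a, a ≠ 0 ∧ c̄·zᵀ(J₀N(u))z = a²`.
HONEST LABEL: HC_CM is proved only modulo the 2 remaining named inputs (hLiu418 24832, h413 24833) until rung 0 closes; measure-free group bookkeeping, no books consequence.

## References
* [Rogawski1990] J. D. Rogawski, *Automorphic Representations of Unitary Groups in Three Variables*, Ann. of Math. Stud. 123 (1990): §14.2 p. 233; §4.9 p. 54; §3.9 p. 32.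
* [Kottwitz1986] R. E. Kottwitz, *Base change for unit elements of Hecke algebras*, Compositio Math. 60 (1986): §3 (fixed points on the building; congruence filtration).
* [Flicker1998UnitaryFL] Y. Z. Flicker, *Elementary proof of the fundamental lemma for a unitary group*, Canad. J. Math. 50 (1998): §2 pp. 77–79, §3 Prop. 5.
* [PlatonovRapinchuk1994] V. Platonov, A. Rapinchuk, *Algebraic Groups and Number Theory* (1994): §3.3, §5.1.
-/

set_option autoImplicit false

noncomputable section

open MeasureTheory Measure Set Filter Topology NumberField IsDedekindDomain Matrix ValuativeRel
open Literature.NumberTheory.Rogawski1990 Literature.NumberTheory.GaloisRepresentations Literature.NumberTheory.Automorphic.UnitaryGroup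
open Literature.NumberTheory.Automorphic.IntegralReduction Literature.GroupTheory.SpecificGroups Literature.NumberTheory.Automorphic.UnitaryLatticeTree
open scoped Matrix MatrixGroups ValuativeRel

namespace Literature.NumberTheory.Automorphic.UnitaryGroup

/-! ## §1 Label algebra under conjugation by an integral frame (valued field) -/

section Labels

variable {F : Type*} [Field F] [ValuativeRel F] {n : ℕ}

/-- **LAYER 1 IS FRAME-INVARIANT**: `rank(red(AxA⁻¹) − 1) = rank(red x − 1)` for `A, x ∈ GL_n(𝒪)` (★ `rank_redMat_conj_sub_one_eq` at `k := A⁻¹`). [cite: Kottwitz1986, §3] -/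
theorem rank_redMat_frameConj_sub_one_eq {A x : GL (Fin n) F} (hA : A ∈ glInt n F) (hx : x ∈ glInt n F) :
    (redMat (((A * x * A⁻¹ : GL (Fin n) F)) : Matrix (Fin n) (Fin n) F) - 1).rank = (redMat (x : Matrix (Fin n) (Fin n) F) - 1).rank := by
  have h := rank_redMat_conj_sub_one_eq (inv_mem hA) hx
  rwa [inv_inv] at h

/-- **THE DEPTH-1 RESIDUE UNDER A FRAME**: if `x ∈ GL_n(𝒪)` has `rank(red x − 1) = 0` (so `ϖ⁻¹(x − 1)` is integral, ★ ROW-0) and `A ∈ GL_n(𝒪)`, then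
`red(ϖ⁻¹(AxA⁻¹ − 1)) = red A · red(ϖ⁻¹(x − 1)) · red A⁻¹`. [cite: Kottwitz1986, §3] [cite: PlatonovRapinchuk1994, §3.3] -/
theorem redMat_inv_smul_frameConj_sub_one_eq {ϖ : F} (hϖ : IsUniformizingElement ϖ) {A x : GL (Fin n) F} (hA : A ∈ glInt n F) (hx : x ∈ glInt n F)
    (hr0 : (redMat (x : Matrix (Fin n) (Fin n) F) - 1).rank = 0) :
    redMat (ϖ⁻¹ • ((((A * x * A⁻¹ : GL (Fin n) F)) : Matrix (Fin n) (Fin n) F) - 1)) =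
      redMat (A : Matrix (Fin n) (Fin n) F) * redMat (ϖ⁻¹ • ((x : Matrix (Fin n) (Fin n) F) - 1)) * redMat (((A⁻¹ : GL (Fin n) F)) : Matrix (Fin n) (Fin n) F) := by
  have hint : ValBound 1 (ϖ⁻¹ • ((x : Matrix (Fin n) (Fin n) F) - 1)) := by
    have hle := (rank_redMat_sub_one_eq_zero_iff_forall_valuation_le hϖ hx).1 hr0
    have hϖ0 : ϖ ≠ 0 := hϖ.ne_zero
    intro i j
    rw [Matrix.smul_apply, smul_eq_mul, map_mul, map_inv₀]
    have hvϖ : valuation F ϖ ≠ 0 := (Valuation.ne_zero_iff _).2 hϖ0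
    calc (valuation F ϖ)⁻¹ * valuation F (((x : Matrix (Fin n) (Fin n) F) - 1) i j) ≤ (valuation F ϖ)⁻¹ * valuation F ϖ := by gcongr; exact hle i j
      _ = 1 := inv_mul_cancel₀ hvϖ
  have hconj : ϖ⁻¹ • ((((A * x * A⁻¹ : GL (Fin n) F)) : Matrix (Fin n) (Fin n) F) - 1) =
      (A : Matrix (Fin n) (Fin n) F) * (ϖ⁻¹ • ((x : Matrix (Fin n) (Fin n) F) - 1)) * (((A⁻¹ : GL (Fin n) F)) : Matrix (Fin n) (Fin n) F) := by
    rw [Units.val_mul, Units.val_mul, Matrix.mul_smul, Matrix.smul_mul, Matrix.mul_sub, Matrix.sub_mul, Matrix.mul_one, Units.mul_inv]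
  have hAv : ValBound 1 (A : Matrix (Fin n) (Fin n) F) := valBound_one_of_mem_glInt hA
  have hAiv : ValBound 1 (((A⁻¹ : GL (Fin n) F)) : Matrix (Fin n) (Fin n) F) := valBound_one_of_mem_glInt (inv_mem hA)
  have h1 : ValBound 1 ((A : Matrix (Fin n) (Fin n) F) * (ϖ⁻¹ • ((x : Matrix (Fin n) (Fin n) F) - 1))) := by have h := hAv.mul hint; rwa [one_mul] at h
  rw [hconj, redMat_mul h1 hAiv, redMat_mul hAv hint]

/-- **THE INTERIOR RANK IS FRAME-INVARIANT**: under the hypotheses of ★ `redMat_inv_smul_frameConj_sub_one_eq`, `rank(red(ϖ⁻¹(AxA⁻¹ − 1))) = rank(red(ϖ⁻¹(x − 1)))`.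
[cite: Kottwitz1986, §3] -/
theorem rank_redMat_inv_smul_frameConj_sub_one_eq {ϖ : F} (hϖ : IsUniformizingElement ϖ) {A x : GL (Fin n) F} (hA : A ∈ glInt n F) (hx : x ∈ glInt n F)
    (hr0 : (redMat (x : Matrix (Fin n) (Fin n) F) - 1).rank = 0) :
    (redMat (ϖ⁻¹ • ((((A * x * A⁻¹ : GL (Fin n) F)) : Matrix (Fin n) (Fin n) F) - 1))).rank = (redMat (ϖ⁻¹ • ((x : Matrix (Fin n) (Fin n) F) - 1))).rank := by
  rw [redMat_inv_smul_frameConj_sub_one_eq hϖ hA hx hr0]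
  -- `red A`, `red A⁻¹` are mutually inverse
  have h1 : redMat (A : Matrix (Fin n) (Fin n) F) * redMat (((A⁻¹ : GL (Fin n) F)) : Matrix (Fin n) (Fin n) F) = 1 := redMat_coe_mul_redMat_coe_inv hA
  have h2 : redMat (((A⁻¹ : GL (Fin n) F)) : Matrix (Fin n) (Fin n) F) * redMat (A : Matrix (Fin n) (Fin n) F) = 1 := redMat_coe_inv_mul_redMat_coe hA
  have hdA : IsUnit (redMat (A : Matrix (Fin n) (Fin n) F)).det := Matrix.isUnit_det_of_right_inverse h1
  have hdAi : IsUnit (redMat (((A⁻¹ : GL (Fin n) F)) : Matrix (Fin n) (Fin n) F)).det := Matrix.isUnit_det_of_right_inverse h2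
  rw [Matrix.rank_mul_eq_left_of_isUnit_det _ _ hdAi, Matrix.rank_mul_eq_right_of_isUnit_det _ _ hdA]

end Labels

/-! ## §1b The residual quadratic form under a frame and under `O(J₀)` (field with the split form `J₀`) -/

section Form

variable {K : Type*} [Field K]

/-- **THE CLASS «□» UNDER THE FRAME TWIST**: for `J̄ = c • ᵗĀ J₀ Ā` (`c ≠ 0`), `(∃ z a, a ≠ 0 ∧ zᵀ(J̄N)z = a²) ↔ (∃ z a, a ≠ 0 ∧ c·zᵀ(J₀·ĀNĀ⁻¹)z = a²)` (★ p846957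
`dotProduct_smul_formCongr_mul_mulVec`, `z ↦ Āz`). [cite: Rogawski1990, §3.9 p. 32] [cite: PlatonovRapinchuk1994, §3.3] -/
theorem exists_sq_value_iff_frameConj (Ab : GL (Fin 3) K) (c : K) (N : Matrix (Fin 3) (Fin 3) K) :
    (∃ (z : Fin 3 → K) (a : K), a ≠ 0 ∧ z ⬝ᵥ ((c • formCongr (RingHom.id K) Ab ((StdForm.antidiagonal 3).over K) * N) *ᵥ z) = a ^ 2) ↔
      ∃ (z : Fin 3 → K) (a : K), a ≠ 0 ∧
        c * (z ⬝ᵥ ((((StdForm.antidiagonal 3).over K) * ((Ab : Matrix (Fin 3) (Fin 3) K) * N * ((Ab⁻¹ : GL (Fin 3) K) : Matrix (Fin 3) (Fin 3) K))) *ᵥ z)) = a ^ 2 := by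
  constructor
  · rintro ⟨z, a, ha, hz⟩
    exact ⟨(Ab : Matrix (Fin 3) (Fin 3) K) *ᵥ z, a, ha, by rw [← dotProduct_smul_formCongr_mul_mulVec]; exact hz⟩
  · rintro ⟨z, a, ha, hz⟩
    refine ⟨((Ab⁻¹ : GL (Fin 3) K) : Matrix (Fin 3) (Fin 3) K) *ᵥ z, a, ha, ?_⟩
    rw [dotProduct_smul_formCongr_mul_mulVec, Matrix.mulVec_mulVec, ← Units.val_mul, mul_inv_cancel, Units.val_one, Matrix.one_mulVec]
    exact hz

/-- **THE CLASS IS `O(J₀)`-INVARIANT**: for `g ∈ O(J₀)`, `(∃ z a, a ≠ 0 ∧ c·zᵀ(J₀(g⁻¹Ng))z = a²) ↔ (∃ z a, a ≠ 0 ∧ c·zᵀ(J₀N)z = a²)` (★ `dotProduct_mulVec_conj_of_mem`, `z ↦ gz`).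
[cite: Rogawski1990, §3.9 p. 32] -/
theorem exists_sq_value_conj_iff_of_mem {g : GL (Fin 3) K} (hg : g ∈ unitaryGroupOfForm (RingHom.id K) ((StdForm.antidiagonal 3).over K)) (c : K)
    (N : Matrix (Fin 3) (Fin 3) K) :
    (∃ (z : Fin 3 → K) (a : K), a ≠ 0 ∧
        c * (z ⬝ᵥ ((((StdForm.antidiagonal 3).over K) * (((g⁻¹ : GL (Fin 3) K) : Matrix (Fin 3) (Fin 3) K) * N * (g : Matrix (Fin 3) (Fin 3) K))) *ᵥ z)) = a ^ 2) ↔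
      ∃ (z : Fin 3 → K) (a : K), a ≠ 0 ∧ c * (z ⬝ᵥ ((((StdForm.antidiagonal 3).over K) * N) *ᵥ z)) = a ^ 2 := by
  constructor
  · rintro ⟨z, a, ha, hz⟩
    exact ⟨(g : Matrix (Fin 3) (Fin 3) K) *ᵥ z, a, ha, by rw [← dotProduct_mulVec_conj_of_mem hg]; exact hz⟩
  · rintro ⟨z, a, ha, hz⟩
    refine ⟨((g⁻¹ : GL (Fin 3) K) : Matrix (Fin 3) (Fin 3) K) *ᵥ z, a, ha, ?_⟩
    rw [dotProduct_mulVec_conj_of_mem hg, Matrix.mulVec_mulVec, ← Units.val_mul, mul_inv_cancel, Units.val_one, Matrix.one_mulVec]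
    exact hz

end Form

/-! ## §2 The CM place: reduction of the frame identity, residual units of integral unitary elements, the MASTER transport -/

section Place

variable (L : Type) [Field L] [NumberField L] [IsCMField L] (H' : Matrix (Fin 3) (Fin 3) L) {v : HeightOneSpectrum (𝓞 ↥(maximalRealSubfield L))}

omit [IsCMField L] in
/-- `red(Φ₃,w) = J₀` over the residue field (entries `0, 1`). [cite: Rogawski1990, §4.9 p. 54] -/
theorem redMat_placeForm_antidiagThree (w : PlacesOver L v) :
    redMat (placeForm (Matrix.of fun i j : Fin 3 => if i.val + j.val + 1 = 3 then (1 : L) else 0) w.1) = ((StdForm.antidiagonal 3).over 𝓀[(w.1.adicCompletion L)]) := by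
  rw [placeForm_antidiagOne]
  have h : (StdForm.antidiagonal 3).over (w.1.adicCompletion L) = (𝒪[(w.1.adicCompletion L)]).subtype.mapMatrix ((StdForm.antidiagonal 3).over 𝒪[(w.1.adicCompletion L)]) := by
    rw [RingHom.mapMatrix_apply, StdForm.over_map]
  rw [h, redMat_mapMatrix, RingHom.mapMatrix_apply, StdForm.over_map]

set_option maxHeartbeats 800000 in
-- budget only: statement-heavy CM-place tokens.
/-- **THE FRAME IDENTITY, REDUCED**: from `H′_w = (−det H′_w) • ᵗσ̄A Φ₃ A` (`A ∈ GL₃(𝒪_w)`, tame-ramified `w` so `σ̄_w = id`):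
`red H′_w = red(−det H′_w) • ᵗ(red A) J₀ (red A)` — i.e. `J̄ = c̄ • formCongr id Ā J₀` for the residual unit `Ā = (red A, red A⁻¹)`. [cite: PlatonovRapinchuk1994, §3.3] [cite: Rogawski1990, §4.9 p. 54] -/
theorem redMat_placeForm_eq_smul_formCongr_redMat_of_frame (w : PlacesOver L v)
    (hw : IsCMField.complexConj L • w.1 = w.1) (he : v.asIdeal.ramificationIdx' w.1.asIdeal ≠ 1)
    (hH'w : IsUnit (placeForm H' w.1)) (hH'i : hH'w.unit ∈ glInt 3 (w.1.adicCompletion L))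
    (A : GL (Fin 3) (w.1.adicCompletion L)) (hA : A ∈ glInt 3 (w.1.adicCompletion L))
    (hframe : (placeForm H' w.1) = (-(placeForm H' w.1).det) • formCongr (galAdicCompletionMap (L := L) (IsCMField.complexConj L) hw) A ((StdForm.antidiagonal 3).over (w.1.adicCompletion L)))
    (Ab : GL (Fin 3) 𝓀[(w.1.adicCompletion L)]) (hAb : (Ab : Matrix (Fin 3) (Fin 3) 𝓀[(w.1.adicCompletion L)]) = redMat (A : Matrix (Fin 3) (Fin 3) (w.1.adicCompletion L))) :
    redMat (placeForm H' w.1) = red (-((placeForm H' w.1)).det) • formCongr (RingHom.id 𝓀[(w.1.adicCompletion L)]) Ab ((StdForm.antidiagonal 3).over 𝓀[(w.1.adicCompletion L)]) := by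
  have hJint : ∀ i j, (placeForm H' w.1) i j ∈ 𝒪[(w.1.adicCompletion L)] := fun i j => ((mem_glInt_iff _).1 hH'i).1 i j
  have hAv : ValBound 1 (A : Matrix (Fin 3) (Fin 3) (w.1.adicCompletion L)) := valBound_one_of_mem_glInt hA
  have hAint : ∀ i j, (A : Matrix (Fin 3) (Fin 3) (w.1.adicCompletion L)) i j ∈ 𝒪[(w.1.adicCompletion L)] := fun i j => (Valuation.mem_integer_iff _ _).2 (hAv i j)
  -- `−det H′_w ∈ 𝒪`
  let JO : Matrix (Fin 3) (Fin 3) 𝒪[(w.1.adicCompletion L)] := Matrix.of fun i j => ⟨(placeForm H' w.1) i j, hJint i j⟩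
  have hJ : (placeForm H' w.1) = JO.map ((↑) : 𝒪[(w.1.adicCompletion L)] → (w.1.adicCompletion L)) := by ext i j; rfl
  have hc : (-(placeForm H' w.1).det) ∈ 𝒪[(w.1.adicCompletion L)] := by
    have h : (placeForm H' w.1).det = ((JO.det : 𝒪[(w.1.adicCompletion L)]) : (w.1.adicCompletion L)) := by rw [hJ]; exact RingHom.map_det (𝒪[(w.1.adicCompletion L)]).subtype JO
    rw [h]; exact Subring.neg_mem _ (JO.det).2
  -- reduce the frame identity
  have hΦ : ValBound 1 ((StdForm.antidiagonal 3).over (w.1.adicCompletion L)) := by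
    intro i j
    rw [← placeForm_antidiagOne (E := L)]
    exact (Valuation.mem_integer_iff _ _).1 (by
      rw [placeForm_antidiagOne, antidiagonal_three_over_eq]
      fin_cases i <;> fin_cases j <;> simp [zero_mem, one_mem])
  have hσA : ValBound 1 ((A : Matrix (Fin 3) (Fin 3) (w.1.adicCompletion L)).map (galAdicCompletionMap (L := L) (IsCMField.complexConj L) hw)) := fun a b => by
    rw [Matrix.map_apply]
    exact (Valuation.mem_integer_iff _ _).1 (red_galAdicCompletionMap_eq_of_ramified L v w hw he (hAint a b)).1
  have hσAT : ValBound 1 ((A : Matrix (Fin 3) (Fin 3) (w.1.adicCompletion L)).map (galAdicCompletionMap (L := L) (IsCMField.complexConj L) hw))ᵀ := IntegralReduction.ValBound.transpose' hσA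
  have h1 : ValBound 1 (((A : Matrix (Fin 3) (Fin 3) (w.1.adicCompletion L)).map (galAdicCompletionMap (L := L) (IsCMField.complexConj L) hw))ᵀ * (StdForm.antidiagonal 3).over (w.1.adicCompletion L)) := by
    have h := hσAT.mul hΦ; rwa [one_mul] at h
  have h2 : ValBound 1 (((A : Matrix (Fin 3) (Fin 3) (w.1.adicCompletion L)).map (galAdicCompletionMap (L := L) (IsCMField.complexConj L) hw))ᵀ * (StdForm.antidiagonal 3).over (w.1.adicCompletion L) * (A : Matrix (Fin 3) (Fin 3) (w.1.adicCompletion L))) := by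
    have h := h1.mul hAv; rwa [one_mul] at h
  have hred := congrArg redMat hframe
  rw [formCongr, redMat_smul hc h2, redMat_mul h1 hAv, redMat_mul hσAT hΦ, redMat_transpose,
    redMat_map_galAdicCompletionMap_eq_of_ramified L v w hw he hAint, ← placeForm_antidiagOne (E := L), redMat_placeForm_antidiagThree] at hred
  rw [hred, formCongr, map_ringHom_id_eq, hAb]

variable (w : PlacesOver L v) (hw : IsCMField.complexConj L • w.1 = w.1)

include hw in
set_option maxHeartbeats 800000 in
-- budget only: statement-heavy CM-place tokens.
/-- **THE RESIDUAL UNIT OF AN INTEGRAL ELEMENT OF `U(σ_w, Φ₃)` LIES IN `O(J₀)(𝓀_w)`** at a tame-ramified place (unitarity `ᵗσ̄(k) Φ₃ k = Φ₃` reduced with `σ̄_w = id`):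
for `k ∈ U ∩ GL₃(𝒪_w)` there is `ḡ ∈ O(J₀)(𝓀_w)` with `ḡ = red k`, `ḡ⁻¹ = red k⁻¹`. [cite: Rogawski1990, §3.9 p. 32] [cite: PlatonovRapinchuk1994, §3.3] -/
theorem exists_residual_orthogonal_of_mem_glInt (he : v.asIdeal.ramificationIdx' w.1.asIdeal ≠ 1) {k : ↥(unitaryGroupOfForm (galAdicCompletionMap (L := L) (IsCMField.complexConj L) hw) (placeForm (Matrix.of fun i j : Fin 3 => if i.val + j.val + 1 = 3 then (1 : L) else 0) w.1))} (hk : ((k : ↥(unitaryGroupOfForm (galAdicCompletionMap (L := L) (IsCMField.complexConj L) hw) (placeForm (Matrix.of fun i j : Fin 3 => if i.val + j.val + 1 = 3 then (1 : L) else 0) w.1))) : GL (Fin 3) (w.1.adicCompletion L)) ∈ glInt 3 (w.1.adicCompletion L)) :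
    ∃ g : GL (Fin 3) 𝓀[(w.1.adicCompletion L)], g ∈ unitaryGroupOfForm (RingHom.id 𝓀[(w.1.adicCompletion L)]) ((StdForm.antidiagonal 3).over 𝓀[(w.1.adicCompletion L)]) ∧
      (g : Matrix (Fin 3) (Fin 3) 𝓀[(w.1.adicCompletion L)]) = redMat (((k : ↥(unitaryGroupOfForm (galAdicCompletionMap (L := L) (IsCMField.complexConj L) hw) (placeForm (Matrix.of fun i j : Fin 3 => if i.val + j.val + 1 = 3 then (1 : L) else 0) w.1))) : GL (Fin 3) (w.1.adicCompletion L)) : Matrix (Fin 3) (Fin 3) (w.1.adicCompletion L)) ∧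
      ((g⁻¹ : GL (Fin 3) 𝓀[(w.1.adicCompletion L)]) : Matrix (Fin 3) (Fin 3) 𝓀[(w.1.adicCompletion L)]) = redMat ((((k : ↥(unitaryGroupOfForm (galAdicCompletionMap (L := L) (IsCMField.complexConj L) hw) (placeForm (Matrix.of fun i j : Fin 3 => if i.val + j.val + 1 = 3 then (1 : L) else 0) w.1))) : GL (Fin 3) (w.1.adicCompletion L))⁻¹ : GL (Fin 3) (w.1.adicCompletion L)) : Matrix (Fin 3) (Fin 3) (w.1.adicCompletion L)) := by
  let g : GL (Fin 3) 𝓀[(w.1.adicCompletion L)] := ⟨redMat (((k : ↥(unitaryGroupOfForm (galAdicCompletionMap (L := L) (IsCMField.complexConj L) hw) (placeForm (Matrix.of fun i j : Fin 3 => if i.val + j.val + 1 = 3 then (1 : L) else 0) w.1))) : GL (Fin 3) (w.1.adicCompletion L)) : Matrix (Fin 3) (Fin 3) (w.1.adicCompletion L)), redMat ((((k : ↥(unitaryGroupOfForm (galAdicCompletionMap (L := L) (IsCMField.complexConj L) hw) (placeForm (Matrix.of fun i j : Fin 3 => if i.val + j.val + 1 = 3 then (1 : L) else 0) w.1))) :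 GL (Fin 3) (w.1.adicCompletion L))⁻¹ : GL (Fin 3) (w.1.adicCompletion L)) : Matrix (Fin 3) (Fin 3) (w.1.adicCompletion L)),
    redMat_coe_mul_redMat_coe_inv hk, redMat_coe_inv_mul_redMat_coe hk⟩
  refine ⟨g, ?_, rfl, rfl⟩
  have hkv : ValBound 1 (((k : ↥(unitaryGroupOfForm (galAdicCompletionMap (L := L) (IsCMField.complexConj L) hw) (placeForm (Matrix.of fun i j : Fin 3 => if i.val + j.val + 1 = 3 then (1 : L) else 0) w.1))) : GL (Fin 3) (w.1.adicCompletion L)) : Matrix (Fin 3) (Fin 3) (w.1.adicCompletion L)) := valBound_one_of_mem_glInt hk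
  have hkint : ∀ i j, (((k : ↥(unitaryGroupOfForm (galAdicCompletionMap (L := L) (IsCMField.complexConj L) hw) (placeForm (Matrix.of fun i j : Fin 3 => if i.val + j.val + 1 = 3 then (1 : L) else 0) w.1))) : GL (Fin 3) (w.1.adicCompletion L)) : Matrix (Fin 3) (Fin 3) (w.1.adicCompletion L)) i j ∈ 𝒪[(w.1.adicCompletion L)] := fun i j => (Valuation.mem_integer_iff _ _).2 (hkv i j)
  have hU : (((((k : ↥(unitaryGroupOfForm (galAdicCompletionMap (L := L) (IsCMField.complexConj L) hw) (placeForm (Matrix.of fun i j : Fin 3 => if i.val + j.val + 1 = 3 then (1 : L) else 0) w.1))) : GL (Fin 3) (w.1.adicCompletion L)) : Matrix (Fin 3) (Fin 3) (w.1.adicCompletion L))).map (galAdicCompletionMap (L := L) (IsCMField.complexConj L) hw))ᵀ * (placeForm (Matrix.of fun i j : Fin 3 => if i.val + j.val + 1 = 3 then (1 : L) else 0) w.1) * (((k : ↥(unitaryGroupOfForm (galAdicCompletionMap (L := L) (IsCMField.complexConj L) hw) (placeForm (Matrix.of fun i j : Fin 3 => if i.val + j.val + 1 = 3 then (1 : L)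 else 0) w.1))) : GL (Fin 3) (w.1.adicCompletion L)) : Matrix (Fin 3) (Fin 3) (w.1.adicCompletion L)) = (placeForm (Matrix.of fun i j : Fin 3 => if i.val + j.val + 1 = 3 then (1 : L) else 0) w.1) := mem_unitaryGroupOfForm_iff.1 k.2
  have hΦ : ValBound 1 (placeForm (Matrix.of fun i j : Fin 3 => if i.val + j.val + 1 = 3 then (1 : L) else 0) w.1) := by
    intro i j
    exact (Valuation.mem_integer_iff _ _).1 (by
      rw [placeForm_antidiagOne, antidiagonal_three_over_eq]
      fin_cases i <;> fin_cases j <;> simp [zero_mem, one_mem])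
  have hσk : ValBound 1 (((((k : ↥(unitaryGroupOfForm (galAdicCompletionMap (L := L) (IsCMField.complexConj L) hw) (placeForm (Matrix.of fun i j : Fin 3 => if i.val + j.val + 1 = 3 then (1 : L) else 0) w.1))) : GL (Fin 3) (w.1.adicCompletion L)) : Matrix (Fin 3) (Fin 3) (w.1.adicCompletion L))).map (galAdicCompletionMap (L := L) (IsCMField.complexConj L) hw)) := fun a b => by
    rw [Matrix.map_apply]
    exact (Valuation.mem_integer_iff _ _).1 (red_galAdicCompletionMap_eq_of_ramified L v w hw he (hkint a b)).1
  have hσkT : ValBound 1 (((((k : ↥(unitaryGroupOfForm (galAdicCompletionMap (L := L) (IsCMField.complexConj L) hw) (placeForm (Matrix.of fun i j : Fin 3 => if i.val + j.val + 1 = 3 then (1 : L) else 0) w.1))) : GL (Fin 3) (w.1.adicCompletion L)) : Matrix (Fin 3) (Fin 3) (w.1.adicCompletion L))).map (galAdicCompletionMap (L := L) (IsCMField.complexConj L) hw))ᵀ := IntegralReduction.ValBound.transpose' hσk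
  have h1 : ValBound 1 ((((((k : ↥(unitaryGroupOfForm (galAdicCompletionMap (L := L) (IsCMField.complexConj L) hw) (placeForm (Matrix.of fun i j : Fin 3 => if i.val + j.val + 1 = 3 then (1 : L) else 0) w.1))) : GL (Fin 3) (w.1.adicCompletion L)) : Matrix (Fin 3) (Fin 3) (w.1.adicCompletion L))).map (galAdicCompletionMap (L := L) (IsCMField.complexConj L) hw))ᵀ * (placeForm (Matrix.of fun i j : Fin 3 => if i.val + j.val + 1 = 3 then (1 : L) else 0) w.1)) := by have h := hσkT.mul hΦ; rwa [one_mul] at h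
  have hred := congrArg redMat hU
  rw [redMat_mul h1 hkv, redMat_mul hσkT hΦ, redMat_transpose, redMat_map_galAdicCompletionMap_eq_of_ramified L v w hw he hkint,
    redMat_placeForm_antidiagThree] at hred
  rw [mem_unitaryGroupOfForm_iff, map_ringHom_id_eq]
  exact hred

include hw in
set_option maxHeartbeats 1600000 in
-- budget only: statement-heavy CM-place tokens; the generic ★ `ncard_fixedBy_sep_congr` is applied once.
/-- **MASTER TRANSPORT** along the frame `e` (`e g = A·g_w·A⁻¹`, `g ∈ K′ ↔ e g ∈ GL₃(𝒪_w)`): for ANY label pair `P` on `G′_v`, `P′` on `U = U(σ_w, Φ₃)(L_w)` that CORRESPOND on `K′`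
(`x ∈ K′ → (P x ↔ P′ (e x))`) with `P′` invariant under `U ∩ GL₃(𝒪_w)`-conjugation, the fixed-coset counts agree:
`#{q ∈ Fix_t(G′_v ⧸ K′) : P(q.out⁻¹ t q.out)} = #{q′ ∈ Fix_{e t}(U ⧸ U ∩ GL₃(𝒪_w)) : P′(q′.out⁻¹ (e t) q′.out)}` (★ `ncard_fixedBy_sep_congr` with the membership conjunct added and removed).
[cite: Rogawski1990, §14.2 p. 233] [cite: Kottwitz1986, §3] -/
theorem ncard_fixedBy_label_eq_of_frame (e : ↥(UnitaryGroup.«local» L (IsCMField.complexConj L) 3 H' v) ≃ₜ* ↥(unitaryGroupOfForm (galAdicCompletionMap (L := L) (IsCMField.complexConj L) hw) (placeForm (Matrix.of fun i j : Fin 3 => if i.val + j.val + 1 = 3 then (1 : L) else 0) w.1)))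
    (hK : ∀ g : ((cmDatum L 3 H').Local v), g ∈ (cmLocalIntegralLevel L 3 H' v) ↔ (((e g) : ↥(unitaryGroupOfForm (galAdicCompletionMap (L := L) (IsCMField.complexConj L) hw) (placeForm (Matrix.of fun i j : Fin 3 => if i.val + j.val + 1 = 3 then (1 : L) else 0) w.1))) : GL (Fin 3) (w.1.adicCompletion L)) ∈ glInt 3 (w.1.adicCompletion L))
    (t : ((cmDatum L 3 H').Local v)) (P : ((cmDatum L 3 H').Local v) → Prop) (P' : ↥(unitaryGroupOfForm (galAdicCompletionMap (L := L) (IsCMField.complexConj L) hw) (placeForm (Matrix.of fun i j : Fin 3 => if i.val + j.val + 1 = 3 then (1 : L) else 0) w.1)) → Prop)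
    (hP : ∀ x : ((cmDatum L 3 H').Local v), x ∈ (cmLocalIntegralLevel L 3 H' v) → (P x ↔ P' (e x)))
    (hP' : ∀ k' : ↥(unitaryGroupOfForm (galAdicCompletionMap (L := L) (IsCMField.complexConj L) hw) (placeForm (Matrix.of fun i j : Fin 3 => if i.val + j.val + 1 = 3 then (1 : L) else 0) w.1)), ((k' : ↥(unitaryGroupOfForm (galAdicCompletionMap (L := L) (IsCMField.complexConj L) hw) (placeForm (Matrix.of fun i j : Fin 3 => if i.val + j.val + 1 = 3 then (1 : L) else 0) w.1))) : GL (Fin 3) (w.1.adicCompletion L)) ∈ glInt 3 (w.1.adicCompletion L) → ∀ u : ↥(unitaryGroupOfForm (galAdicCompletionMap (L := L) (IsCMField.complexConj L) hw) (placeForm (Matrix.of fun i j : Fin 3 => if i.val + j.val + 1 = 3 then (1 : L) else 0) w.1)), ((u : ↥(unitaryGroupOfForm (galAdicCompletionMap (L := L) (IsCMField.complexConj L) hw) (placeForm (Matrix.of fun i j : Fin 3 => if i.val + j.val + 1 = 3 then (1 : L) else 0) w.1))) : GL (Fin 3) (w.1.adicCompletion L)) ∈ glInt 3 (w.1.adicCompletion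 L) → (P' (k'⁻¹ * u * k') ↔ P' u)) :
    {q : (((cmDatum L 3 H').Local v) ⧸ cmLocalIntegralLevel L 3 H' v) | q ∈ MulAction.fixedBy (((cmDatum L 3 H').Local v) ⧸ cmLocalIntegralLevel L 3 H' v) t ∧ P (q.out⁻¹ * t * q.out)}.ncard =
      {q : (↥(unitaryGroupOfForm (galAdicCompletionMap (L := L) (IsCMField.complexConj L) hw) (placeForm (Matrix.of fun i j : Fin 3 => if i.val + j.val + 1 = 3 then (1 : L) else 0) w.1)) ⧸ ((glInt 3 (w.1.adicCompletion L)).subgroupOf (unitaryGroupOfForm (galAdicCompletionMap (L := L) (IsCMField.complexConj L) hw) (placeForm (Matrix.of fun i j : Fin 3 => if i.val + j.val + 1 = 3 then (1 : L) else 0) w.1)))) | q ∈ MulAction.fixedBy (↥(unitaryGroupOfForm (galAdicCompletionMap (L := L) (IsCMField.complexConj L) hw) (placeForm (Matrix.of fun i j : Fin 3 => if i.val + j.val + 1 = 3 then (1 : L) else 0) w.1)) ⧸ ((glInt 3 (w.1.adicCompletion L)).subgroupOf (unitaryGroupOfForm (galAdicCompletionMap (L := L) (IsCMField.complexConj L)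 hw) (placeForm (Matrix.of fun i j : Fin 3 => if i.val + j.val + 1 = 3 then (1 : L) else 0) w.1)))) (e t) ∧ P' (q.out⁻¹ * e t * q.out)}.ncard := by
  have hK' : ∀ g : ((cmDatum L 3 H').Local v), g ∈ (cmLocalIntegralLevel L 3 H' v) ↔ e.toMulEquiv g ∈ ((glInt 3 (w.1.adicCompletion L)).subgroupOf (unitaryGroupOfForm (galAdicCompletionMap (L := L) (IsCMField.complexConj L) hw) (placeForm (Matrix.of fun i j : Fin 3 => if i.val + j.val + 1 = 3 then (1 : L) else 0) w.1))) := fun g => by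
    rw [Subgroup.mem_subgroupOf]; exact hK g
  have key := ncard_fixedBy_sep_congr (cmLocalIntegralLevel L 3 H' v) ((glInt 3 (w.1.adicCompletion L)).subgroupOf (unitaryGroupOfForm (galAdicCompletionMap (L := L) (IsCMField.complexConj L) hw) (placeForm (Matrix.of fun i j : Fin 3 => if i.val + j.val + 1 = 3 then (1 : L) else 0) w.1))) e.toMulEquiv hK' t (fun x => x ∈ (cmLocalIntegralLevel L 3 H' v) ∧ P x)
    (fun u => ((u : ↥(unitaryGroupOfForm (galAdicCompletionMap (L := L) (IsCMField.complexConj L) hw) (placeForm (Matrix.of fun i j : Fin 3 => if i.val + j.val + 1 = 3 then (1 : L) else 0) w.1))) : GL (Fin 3) (w.1.adicCompletion L)) ∈ glInt 3 (w.1.adicCompletion L) ∧ P' u)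
    (fun x => by
      change (x ∈ (cmLocalIntegralLevel L 3 H' v) ∧ P x) ↔ ((((e x) : ↥(unitaryGroupOfForm (galAdicCompletionMap (L := L) (IsCMField.complexConj L) hw) (placeForm (Matrix.of fun i j : Fin 3 => if i.val + j.val + 1 = 3 then (1 : L) else 0) w.1))) : GL (Fin 3) (w.1.adicCompletion L)) ∈ glInt 3 (w.1.adicCompletion L) ∧ P' (e x))
      constructor
      · rintro ⟨hx, hPx⟩; exact ⟨(hK x).1 hx, (hP x hx).1 hPx⟩
      · rintro ⟨hx, hPx⟩; exact ⟨(hK x).2 hx, (hP x ((hK x).2 hx)).2 hPx⟩)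
    (fun k' hk' u hu => by
      rw [Subgroup.mem_subgroupOf] at hk' hu
      change ((((k'⁻¹ * u * k' : ↥(unitaryGroupOfForm (galAdicCompletionMap (L := L) (IsCMField.complexConj L) hw) (placeForm (Matrix.of fun i j : Fin 3 => if i.val + j.val + 1 = 3 then (1 : L) else 0) w.1)))) : GL (Fin 3) (w.1.adicCompletion L)) ∈ glInt 3 (w.1.adicCompletion L) ∧ P' (k'⁻¹ * u * k')) ↔ (((u : ↥(unitaryGroupOfForm (galAdicCompletionMap (L := L) (IsCMField.complexConj L) hw) (placeForm (Matrix.of fun i j : Fin 3 => if i.val + j.val + 1 = 3 then (1 : L) else 0) w.1))) : GL (Fin 3) (w.1.adicCompletion L)) ∈ glInt 3 (w.1.adicCompletion L) ∧ P' u)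
      have hmem : (((k'⁻¹ * u * k' : ↥(unitaryGroupOfForm (galAdicCompletionMap (L := L) (IsCMField.complexConj L) hw) (placeForm (Matrix.of fun i j : Fin 3 => if i.val + j.val + 1 = 3 then (1 : L) else 0) w.1)))) : GL (Fin 3) (w.1.adicCompletion L)) ∈ glInt 3 (w.1.adicCompletion L) := by
        rw [Subgroup.coe_mul, Subgroup.coe_mul, Subgroup.coe_inv]
        exact mul_mem (mul_mem (inv_mem hk') hu) hk'
      exact ⟨fun ⟨_, h⟩ => ⟨hu, (hP' k' hk' u hu).1 h⟩, fun ⟨_, h⟩ => ⟨hmem, (hP' k' hk' u hu).2 h⟩⟩)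
  -- strip the membership conjuncts (automatic on fixed cosets)
  have hL : {q : (((cmDatum L 3 H').Local v) ⧸ cmLocalIntegralLevel L 3 H' v) | q ∈ MulAction.fixedBy (((cmDatum L 3 H').Local v) ⧸ cmLocalIntegralLevel L 3 H' v) t ∧ P (q.out⁻¹ * t * q.out)} =
      {q : (((cmDatum L 3 H').Local v) ⧸ cmLocalIntegralLevel L 3 H' v) | q ∈ MulAction.fixedBy (((cmDatum L 3 H').Local v) ⧸ cmLocalIntegralLevel L 3 H' v) t ∧ ((q.out⁻¹ * t * q.out) ∈ (cmLocalIntegralLevel L 3 H' v) ∧ P (q.out⁻¹ * t * q.out))} := by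
    ext q
    exact ⟨fun ⟨hq, h⟩ => ⟨hq, inv_out_mul_mul_out_mem_of_mem_fixedBy (cmLocalIntegralLevel L 3 H' v) t hq, h⟩, fun ⟨hq, h⟩ => ⟨hq, h.2⟩⟩
  have hR : {q : (↥(unitaryGroupOfForm (galAdicCompletionMap (L := L) (IsCMField.complexConj L) hw) (placeForm (Matrix.of fun i j : Fin 3 => if i.val + j.val + 1 = 3 then (1 : L) else 0) w.1)) ⧸ ((glInt 3 (w.1.adicCompletion L)).subgroupOf (unitaryGroupOfForm (galAdicCompletionMap (L := L) (IsCMField.complexConj L) hw) (placeForm (Matrix.of fun i j : Fin 3 => if i.val + j.val + 1 = 3 then (1 : L) else 0) w.1)))) | q ∈ MulAction.fixedBy (↥(unitaryGroupOfForm (galAdicCompletionMap (L := L) (IsCMField.complexConj L) hw) (placeForm (Matrix.of fun i j : Fin 3 => if i.val + j.val + 1 = 3 then (1 : L) else 0) w.1)) ⧸ ((glInt 3 (w.1.adicCompletion L)).subgroupOf (unitaryGroupOfForm (galAdicCompletionMap (L := L) (IsCMField.complexConj L) hw) (placeForm (Matrix.of fun i j : Fin 3 => if i.val + j.val + 1 =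 3 then (1 : L) else 0) w.1)))) (e t) ∧ P' (q.out⁻¹ * e t * q.out)} =
      {q : (↥(unitaryGroupOfForm (galAdicCompletionMap (L := L) (IsCMField.complexConj L) hw) (placeForm (Matrix.of fun i j : Fin 3 => if i.val + j.val + 1 = 3 then (1 : L) else 0) w.1)) ⧸ ((glInt 3 (w.1.adicCompletion L)).subgroupOf (unitaryGroupOfForm (galAdicCompletionMap (L := L) (IsCMField.complexConj L) hw) (placeForm (Matrix.of fun i j : Fin 3 => if i.val + j.val + 1 = 3 then (1 : L) else 0) w.1)))) | q ∈ MulAction.fixedBy (↥(unitaryGroupOfForm (galAdicCompletionMap (L := L) (IsCMField.complexConj L) hw) (placeForm (Matrix.of fun i j : Fin 3 => if i.val + j.val + 1 = 3 then (1 : L) else 0) w.1)) ⧸ ((glInt 3 (w.1.adicCompletion L)).subgroupOf (unitaryGroupOfForm (galAdicCompletionMap (L := L) (IsCMField.complexConj L) hw) (placeForm (Matrix.of fun i j : Fin 3 => if i.val + j.val + 1 = 3 then (1 : L) else 0) w.1)))) (e.toMulEquiv t) ∧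
        ((((q.out⁻¹ * e.toMulEquiv t * q.out : ↥(unitaryGroupOfForm (galAdicCompletionMap (L := L) (IsCMField.complexConj L) hw) (placeForm (Matrix.of fun i j : Fin 3 => if i.val + j.val + 1 = 3 then (1 : L) else 0) w.1)))) : GL (Fin 3) (w.1.adicCompletion L)) ∈ glInt 3 (w.1.adicCompletion L) ∧ P' (q.out⁻¹ * e.toMulEquiv t * q.out))} := by
    have het : e.toMulEquiv t = e t := rfl
    rw [het]
    ext q
    exact ⟨fun ⟨hq, h⟩ => ⟨hq, Subgroup.mem_subgroupOf.1 (inv_out_mul_mul_out_mem_of_mem_fixedBy ((glInt 3 (w.1.adicCompletion L)).subgroupOf (unitaryGroupOfForm (galAdicCompletionMap (L := L) (IsCMField.complexConj L) hw) (placeForm (Matrix.of fun i j : Fin 3 => if i.val + j.val + 1 = 3 then (1 : L) else 0) w.1))) (e t) hq), h⟩, fun ⟨hq, h⟩ => ⟨hq, h.2⟩⟩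
  rw [hL, hR]
  exact key

end Place

end Literature.NumberTheory.Automorphic.UnitaryGroup

end
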